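import Literature.NumberTheory.LFunctions.SuzukiWeilHilbertSpaceDefs
import Literature.NumberTheory.LFunctions.RiemannXiLogDeriv
import Literature.NumberTheory.LFunctions.LagariasXiPositivityEq14Proofs
import Literature.Analysis.DeBrangesSpaces.Basic
import HarnessLib

/-!
# Lagarias' structure function `E_ξ = ξ(½ − iz) + ξ′(½ − iz)`: the Hermite–Biehler criterion for RH

LINE 1 — LABELS. `Lagarias2006_thm1` («`E_ξ` is a Hermite–Biehler function ⟺ RH») and
`Suzuki2023b_prop31` (the same with «`Θ_ξ = E_ξ♯/E_ξ` is a meromorphic inner function») are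
RH-EQUIVALENT statements, PRINTED both ways; «RH ⟹ `E_ξ` ∈ HB» (`Lagarias2006_thm1_onlyif`) is an
RH-CONSEQUENCE; «`E_ξ` ∈ HB ⟹ RH» (`Lagarias2006_thm1_if`) is an RH-FREE lemma ABOUT the criterion
whose hypothesis is never available unconditionally. `IsHermiteBiehler lagariasE` is NEVER asserted in
this module (Conrey–Li guard of the cell rh-crit/dbl, R7). Everything else here (the algebra of `E_ξ`,
`E_ξ♯`, `A = (E_ξ + E_ξ♯)/2 = ξ(½ − iz)`, the real zeros of `E_ξ`) is RH-FREE. Formalising the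
criterion fixes WHICH inequality (`|E_ξ(z̄)| < |E_ξ(z)|` on `ℂ₊`) would prove RH; it does not move RH.
WHAT THIS IS NOT: not a route, not a proof plan for RH, no positivity is asserted; nothing here bears
on the truth of RH.

Sources.
* [La06] J. C. Lagarias, *Hilbert spaces of entire functions and Dirichlet L-functions*, in:
  Frontiers in Number Theory, Physics and Geometry I (Springer, 2006) 365–377, Thm. 1
  (`Lagarias2006`). PRIMARY NOT HELD by the literature store (cite-only acquisition acq-00417 /
  acq-11228): every [La06] statement below is typed from the SECONDARY quotations and carries
  `secondary:`.
* [Su23b] M. Suzuki, *Li coefficients as norms of functions in a model space*, J. Number Theory 252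
  (2023) 177–194 = arXiv:2301.05779, §3.1–§3.3 (held text `paper:arxiv-2301.05779`, chunks p0007
  L1–135 and p0008 L1–4) (`Suzuki2023b`): definitions (3.1) `E`, (3.2) `Θ := E♯/E`, (3.3)
  `A := (E + E♯)/2`; Prop. 3.1 «(1) RH ⟺ (2) `E` is in the Hermite–Biehler class ⟺ (3) `Θ` is a
  meromorphic inner function for `ℂ₊`», with «(1)⟺(2) by [La06]» and the printed proofs of (2)⟹(3),
  (3)⟹(2); p. 8 L1–4: «`A(z) = ξ(1/2 − iz)`, because `E♯(z) = ξ(1/2−iz) − ξ′(1/2−iz)` by the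
  functional equations … Therefore RH is equivalent to all the zeros of `A(z)` lie on the real axis».
* [Su25c] M. Suzuki, *On the Hilbert space derived from the Weil distribution*, Canad. J. Math.
  (2025) = arXiv:2301.00421 (`Suzuki2025WeilHilbertSpace`), eq. (1.2) p. 2 («`E_ξ` … belongs to the
  Hermite–Biehler class by the RH ([La06])») and p. 6 L52–53 («`E` has a zero on the real line if
  `A(z) = ξ(1/2 − iz)` has a zero with multiplicity `≥ 2`»).

Tree vocabulary (CITED, not restated): `lagariasE`, `lagariasTheta`, `differentiable_lagariasE`,
`norm_lagariasTheta_ofReal` (`SuzukiWeilHilbertSpaceDefs.lean`); `riemannXi`, `riemannXi_one_sub`,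
`riemannXi_conj_holds`, `deriv_riemannXi_one_sub`, `deriv_riemannXi_conj`,
`riemannHypothesis_iff_im_eq_zero_of_riemannXiUpper_eq_zero_holds` (RH ⟺ all zeros of `Ξ` real);
`Literature.Analysis.DeBrangesSpaces.sharp` / `IsHermiteBiehler` (INEQUALITY-ONLY Hermite–Biehler
predicate = [Su23b] §3.1 p. 7 L62–64; NOT `IsSuzukiHB`, whose extra «no real zeros» conjunct would turn
«RH ⟹ HB» into the OPEN simplicity statement, see `lagariasE_ofReal_eq_zero_iff`);
`Lagarias1999_riemannHypothesis_iff_holds` (RH ⟺ `Re ξ′/ξ > 0` on `Re s > ½`, the input of the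
discharge of `Lagarias2006_thm1_onlyif`). Siblings: `lagarias2005_lemma_2_1` (the SHIFT structure
functions `ξ(s + h)`), `riemannHypothesis_iff_forall_isSuzukiHB` (Suzuki's family `E^{ω,ν}`); ours is
the DERIVATIVE structure function.

Deliberately NOT here. [Su23b] Prop. 3.2 (under RH, `{√(m_γ/π)·i(1+Θ(z))/(2(z−γ))}_γ` is an
orthonormal basis of the model space `𝒦(Θ) = H² ⊖ ΘH²`) is NOT TYPED: it needs Hardy-space /
model-space vocabulary on `ℂ₊` (`H²(ℂ₊)` as a closed subspace of `L²(ℝ)`), absent from Mathlib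
(cell GAP F6′); no Hardy-space library is improvised here. The discharges of `Suzuki2023b_prop31`
((2)⟹(3) RH-free; (3)⟹(1) via Phragmén–Lindelöf and the maximum modulus principle) live in the
sibling `LagariasXiStructureFunctionProofs.lean`.
-/

noncomputable section

open Complex Filter Set
open scoped ComplexConjugate Topology

namespace Literature.NumberTheory.LFunctions

open Literature.Analysis.DeBrangesSpaces

/-! ## Conjugate symmetry of `E_ξ` (the functional equations) -/

/-- The point `½ − i z̄` is the reflection `conj (1 − s)` of `s = ½ − iz` (bookkeeping for the two
functional equations `ξ(s) = ξ(1 − s)`, `ξ(s̄) = conj ξ(s)`). [folklore] -/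
private theorem one_half_sub_I_mul_conj (z : ℂ) :
    (1 / 2 : ℂ) - I * conj z = conj (1 - (1 / 2 - I * z)) := by
  apply Complex.ext
  · simp; ring
  · simp

/-- `E_ξ(z̄) = conj (ξ(s) − ξ′(s))` with `s = ½ − iz`, from `ξ(s) = ξ(1−s)`, `ξ(s̄) = conj ξ(s)` and
their derivatives `ξ′(1−s) = −ξ′(s)`, `ξ′(s̄) = conj ξ′(s)`. RH-FREE.
[cite: Suzuki2023b, §3.3, p. 8 L1–2 («E♯(z) = ξ(1/2−iz) − ξ′(1/2−iz) by functional equations»)] -/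
theorem lagariasE_conj (z : ℂ) :
    lagariasE (conj z) = conj (riemannXi (1 / 2 - I * z) - deriv riemannXi (1 / 2 - I * z)) := by
  unfold lagariasE
  rw [one_half_sub_I_mul_conj, riemannXi_conj_holds, deriv_riemannXi_conj, riemannXi_one_sub,
    deriv_riemannXi_one_sub, map_sub, map_neg]
  ring

/-- **`E_ξ♯(z) = ξ(½ − iz) − ξ′(½ − iz)`** (`F♯(z) = conj F(z̄)`). RH-FREE.
[cite: Suzuki2023b, §3.3, p. 8 L1–2] -/
theorem sharp_lagariasE (z : ℂ) :
    sharp lagariasE z = riemannXi (1 / 2 - I * z) - deriv riemannXi (1 / 2 - I * z) := by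
  rw [sharp_apply, lagariasE_conj, Complex.conj_conj]

/-- `‖E_ξ(z̄)‖ = ‖ξ(s) − ξ′(s)‖`, `s = ½ − iz`: the left-hand side of the Hermite–Biehler inequality
for `E_ξ`. RH-FREE. [cite: Suzuki2023b, §3.3, p. 8 L1–2] -/
theorem norm_lagariasE_conj (z : ℂ) :
    ‖lagariasE (conj z)‖ = ‖riemannXi (1 / 2 - I * z) - deriv riemannXi (1 / 2 - I * z)‖ := by
  rw [lagariasE_conj, Complex.norm_conj]

/-! ## The function `A = (E + E♯)/2` of [Su23b] (3.3) -/

/-- Suzuki's `A(z) := (E(z) + E♯(z))/2` for `E = E_ξ` ([Su23b] (3.3)); it equals `ξ(½ − iz)`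
(`lagariasXiA_eq`). (Named `lagariasXiA` — the `A`-part of the ξ-structure function — to keep clear
of the shift family `A_{h,θ}` of Lagarias 2005.) RH-FREE object.
[cite: Suzuki2023b, §3.3, eq. (3.3), p. 7] -/
def lagariasXiA (z : ℂ) : ℂ :=
  (lagariasE z + sharp lagariasE z) / 2

/-- **`A(z) = ξ(½ − iz)`** ([Su23b] p. 8 L1: «Then `A(z) = ξ(1/2−iz)`, because
`E♯(z) = ξ(1/2−iz) − ξ′(1/2−iz)`»). RH-FREE. [cite: Suzuki2023b, §3.3, p. 8 L1–2] -/
theorem lagariasXiA_eq (z : ℂ) : lagariasXiA z = riemannXi (1 / 2 - I * z) := by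
  unfold lagariasXiA
  rw [sharp_lagariasE]
  unfold lagariasE
  ring

/-- `E_ξ = A + ξ′(½ − i·)`: the decomposition `E = A − iB` with `−iB(z) = ξ′(½ − iz)`. RH-FREE.
[cite: Suzuki2023b, §3.2–3.3, eqs. (3.1), (3.3), p. 7] -/
theorem lagariasE_eq_lagariasXiA_add (z : ℂ) :
    lagariasE z = lagariasXiA z + deriv riemannXi (1 / 2 - I * z) := by
  rw [lagariasXiA_eq]; rfl

/-- `A♯ = A`: `A(z̄) = conj A(z)` (so the zero set of `A` is symmetric under conjugation). RH-FREE.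
[cite: Suzuki2023b, §3.3, p. 8 L1–4] -/
theorem lagariasXiA_conj (z : ℂ) : lagariasXiA (conj z) = conj (lagariasXiA z) := by
  rw [lagariasXiA_eq, lagariasXiA_eq, one_half_sub_I_mul_conj, riemannXi_conj_holds,
    riemannXi_one_sub]

/-- `A(−z) = Ξ(z)` (`Ξ(z) = ξ(½ + iz)` is the tree's `riemannXiUpper`): `A` is Riemann's `Ξ` up to
`z ↦ −z`. RH-FREE. [cite: Suzuki2023b, §3.3, p. 8 L1–4] -/
theorem lagariasXiA_neg (z : ℂ) : lagariasXiA (-z) = riemannXiUpper z := by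
  rw [lagariasXiA_eq, riemannXiUpper]
  congr 1
  ring

/-- **RH ⟺ all zeros of `A(z) = ξ(½ − iz)` are real** ([Su23b] p. 8 L3–4: «Therefore, the Riemann
hypothesis is equivalent to all the zeros of `A(z)` lie on the real axis»). LABEL: RH-EQUIVALENT
(l.1), PRINTED both ways; a reformulation (Riemann's `Ξ`), PROVED from the tree's
`riemannHypothesis_iff_im_eq_zero_of_riemannXiUpper_eq_zero_holds`. Nothing here bears on the truth
of RH. [cite: Suzuki2023b, §3.3, p. 8 L3–4] -/
theorem riemannHypothesis_iff_lagariasXiA_zeros_real :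
    RiemannHypothesis ↔ ∀ z : ℂ, lagariasXiA z = 0 → z.im = 0 := by
  rw [show RiemannHypothesis ↔ ∀ z : ℂ, riemannXiUpper z = 0 → z.im = 0 from
    riemannHypothesis_iff_im_eq_zero_of_riemannXiUpper_eq_zero_holds]
  constructor
  · intro h z hz
    have := h (-z) (by rwa [← lagariasXiA_neg, neg_neg])
    simpa using this
  · intro h z hz
    have := h (-z) (by rwa [lagariasXiA_neg])
    simpa using this

/-! ## Real zeros of `E_ξ` = multiple critical zeros of `ξ` -/

/-- On the critical line `ξ` is real: `conj ξ(½ − ix) = ξ(½ − ix)` for real `x`. RH-FREE.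
[cite: Suzuki2023b, §3.3, p. 8 L1–2 (functional equations ξ(s) = ξ(1−s), ξ(s̄) = conj ξ(s))] -/
theorem conj_riemannXi_critical (x : ℝ) :
    conj (riemannXi (1 / 2 - I * x)) = riemannXi (1 / 2 - I * x) := by
  have h := lagariasXiA_conj (x : ℂ)
  rw [Complex.conj_ofReal, lagariasXiA_eq] at h
  exact h.symm

/-- On the critical line `ξ′` is purely imaginary: `conj ξ′(½ − ix) = −ξ′(½ − ix)` for real `x`.
RH-FREE. [cite: Suzuki2023b, §3.3, p. 8 L1–2 (functional equations)] -/
theorem conj_deriv_riemannXi_critical (x : ℝ) :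
    conj (deriv riemannXi (1 / 2 - I * x)) = -deriv riemannXi (1 / 2 - I * x) := by
  have h : deriv riemannXi (1 / 2 - I * conj (x : ℂ)) = -conj (deriv riemannXi (1 / 2 - I * x)) := by
    rw [one_half_sub_I_mul_conj, deriv_riemannXi_conj, deriv_riemannXi_one_sub, map_neg]
  rw [Complex.conj_ofReal] at h
  -- `h : d = -conj d`; conjugating gives `conj d = -d`
  have h2 := congrArg (starRingEnd ℂ) h
  rw [map_neg, Complex.conj_conj] at h2
  exact h2

/-- **Real zeros of `E_ξ` are the multiple critical zeros of `ξ`**: for real `x`,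
`E_ξ(x) = 0 ⟺ ξ(½ − ix) = 0 ∧ ξ′(½ − ix) = 0` (`ξ` is real and `ξ′` purely imaginary on the critical
line). This is why the INEQUALITY-ONLY Hermite–Biehler predicate is used for `E_ξ`: «`E_ξ` has no real
zeros» is the simplicity of the critical zeros, an OPEN statement. RH-FREE.
[cite: Suzuki2025WeilHilbertSpace, §3.1, p. 6 L52–53 («E has a zero on the real line if A(z) = ξ(1/2 − iz) has a zero with multiplicity ≥ 2»)] -/
theorem lagariasE_ofReal_eq_zero_iff (x : ℝ) :
    lagariasE (x : ℂ) = 0 ↔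
      riemannXi (1 / 2 - I * x) = 0 ∧ deriv riemannXi (1 / 2 - I * x) = 0 := by
  constructor
  · intro h
    have h1 : riemannXi (1 / 2 - I * x) + deriv riemannXi (1 / 2 - I * x) = 0 := h
    have h2 := congrArg conj h1
    rw [map_add, conj_riemannXi_critical, conj_deriv_riemannXi_critical, map_zero] at h2
    constructor
    · linear_combination (h1 + h2) / 2
    · linear_combination (h1 - h2) / 2
  · rintro ⟨h1, h2⟩
    show riemannXi (1 / 2 - I * x) + deriv riemannXi (1 / 2 - I * x) = 0
    rw [h1, h2, add_zero]

/-! ## [La06] Theorem 1: `E_ξ` is a Hermite–Biehler function iff RH -/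

/-- **[La06] Thm. 1, direction «RH ⟹ `E_ξ` is in the Hermite–Biehler class»** (typed from the
secondary quotations [Su23b] Prop. 3.1 (1)⟹(2) «(1) and (2) are equivalent by [La06]», p. 7
L104–111, and [Su25c] p. 2 L95 «belongs to the Hermite–Biehler class by the RH ([La06])»).
LABEL: RH-CONSEQUENCE (explicit `RiemannHypothesis →` binder; never dropped). Hermite–Biehler =
`Literature.Analysis.DeBrangesSpaces.IsHermiteBiehler` (entire ∧ `‖E(z̄)‖ < ‖E(z)‖` on `ℂ₊`, the
printed inequality-only class of [Su23b] §3.1). Discharged below (`Lagarias2006_thm1_onlyif_holds`).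
[cite: Lagarias2006, Thm. 1 — secondary: Suzuki2023b, Prop. 3.1 (1)⇒(2), p. 7] -/
def Lagarias2006_thm1_onlyif : Prop :=
  RiemannHypothesis → IsHermiteBiehler lagariasE

/-- **[La06] Thm. 1, direction «`E_ξ` in the Hermite–Biehler class ⟹ RH»** (typed from the
secondary quotation [Su23b] Prop. 3.1 (2)⟹(1), p. 7 L104–111, with the printed mechanism p. 8 L1–4:
`A = (E + E♯)/2 = ξ(½ − iz)` and RH ⟺ all zeros of `A` real). LABEL: RH-FREE — a lemma ABOUT the
criterion; its hypothesis `IsHermiteBiehler lagariasE` is never available unconditionally.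
Discharged below (`Lagarias2006_thm1_if_holds`).
[cite: Lagarias2006, Thm. 1 — secondary: Suzuki2023b, Prop. 3.1 (2)⇒(1), p. 7–8] -/
def Lagarias2006_thm1_if : Prop :=
  IsHermiteBiehler lagariasE → RiemannHypothesis

/-- **[La06] Thm. 1** «`E_ξ(z) = ξ(½ − iz) + ξ′(½ − iz)` is a de Branges structure function
(Hermite–Biehler: entire with `|E(z̄)| < |E(z)|` on `ℂ₊`) if and only if the Riemann hypothesis
holds» (typed from the secondary quotation [Su23b] Prop. 3.1 «(1) and (2) are equivalent by
[La06]», p. 7 L95–111). LABEL (l.1): RH-EQUIVALENT, PRINTED both ways. Typing it fixes WHICH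
inequality would prove RH; nothing here bears on the truth of RH. Discharged below
(`Lagarias2006_thm1_holds`). [cite: Lagarias2006, Thm. 1 — secondary: Suzuki2023b, Prop. 3.1 (1)⇔(2), p. 7] -/
def Lagarias2006_thm1 : Prop :=
  RiemannHypothesis ↔ IsHermiteBiehler lagariasE

/-! ## [Su23b] Proposition 3.1: the meromorphic-inner reformulation -/

/-- **Meromorphic inner function for `ℂ₊`**, AS PRINTED in [Su23b] §3.1 (p. 7 L14–22): «Let
`H^∞(ℂ₊)` be the space of all bounded analytic functions in `ℂ₊`. An inner function in `ℂ₊` is a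
function `Θ ∈ H^∞(ℂ₊)` such that `lim_{y→0+} |Θ(x+iy)| = 1` for almost all `x ∈ ℝ` with respect to
the Lebesgue measure. If an inner function `Θ` in `ℂ₊` extends to a meromorphic function in the
whole complex plane `ℂ`, it is called a meromorphic inner function in `ℂ₊`.» Typed for a function
`Θ : ℂ → ℂ` (its values off `ℂ₊` are irrelevant except through the last clause): analytic on `ℂ₊` ∧
bounded on `ℂ₊` ∧ a.e. vertical boundary modulus `1` ∧ some function meromorphic on all of `ℂ`
(Mathlib `MeromorphicOn`) agrees with `Θ` on `ℂ₊`. (The contractivity `|Θ| ≤ 1` on `ℂ₊` is NOT part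
of the definition; in print it is a consequence, p. 7 L78–80.)
[cite: Suzuki2023b, §3.1, p. 7 L14–22] -/
def IsMeromorphicInnerUHP (Θ : ℂ → ℂ) : Prop :=
  DifferentiableOn ℂ Θ {z : ℂ | 0 < z.im} ∧
    (∃ C : ℝ, ∀ z : ℂ, 0 < z.im → ‖Θ z‖ ≤ C) ∧
    (∀ᵐ x : ℝ, Tendsto (fun y : ℝ ↦ ‖Θ ((x : ℂ) + I * (y : ℂ))‖) (𝓝[>] 0) (𝓝 1)) ∧
    ∃ Θ' : ℂ → ℂ, MeromorphicOn Θ' Set.univ ∧ ∀ z : ℂ, 0 < z.im → Θ' z = Θ z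

/-- **[Su23b] Prop. 3.1.** «Let `E(z)` and `Θ(z)` be functions defined in (3.1) and (3.2). Then the
following are equivalent: (1) the Riemann hypothesis holds; (2) `E(z)` belongs to the
Hermite–Biehler class; (3) `Θ(z)` is a meromorphic inner function for `ℂ₊`.» Here `E = lagariasE`,
`Θ = lagariasTheta = E♯/E` (Lean division, junk `0` at the zeros of `E` — on `ℂ₊` there are none
under (2); on `ℝ` they form a null set, so clauses of `IsMeromorphicInnerUHP` are junk-robust).
Printed proof: (1)⟺(2) by [La06]; (2)⟹(3) «`Θ` has norm one on the real axis, is analytic in `ℂ₊`,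
and is bounded»; (3)⟹(2) by contradiction through a zero `z₀ ∈ ℂ₊` of `ξ(½ − iz)` giving
`Θ(z₀) = −1` against `|Θ| < 1` on `ℂ₊`. (The held text's proof also mentions an item «(4)» about
model spaces that the printed statement does not list — LOCATOR-UNCLEAR, not typed.) LABEL (l.1):
RH-EQUIVALENT, PRINTED; nothing here bears on the truth of RH. Discharge: sibling Proofs file.
[cite: Suzuki2023b, Prop. 3.1, p. 7 L95–125] -/
def Suzuki2023b_prop31 : Prop :=
  [RiemannHypothesis, IsHermiteBiehler lagariasE, IsMeromorphicInnerUHP lagariasTheta].TFAE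

/-! ## Discharges of [La06] Theorem 1 -/

/-- In the open upper half-plane a Hermite–Biehler `E` has `E(z) + E♯(z) ≠ 0` (else
`‖E(z)‖ = ‖E♯(z)‖ = ‖E(z̄)‖`). RH-FREE; the mechanism of [Su23b] p. 8 L3–4 for `A = (E + E♯)/2`.
[cite: Suzuki2023b, §3.3, p. 8 L1–4] -/
theorem _root_.Literature.Analysis.DeBrangesSpaces.IsHermiteBiehler.add_sharp_ne_zero {E : ℂ → ℂ} (hE : IsHermiteBiehler E) {z : ℂ}
    (hz : 0 < z.im) : E z + sharp E z ≠ 0 := by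
  intro h
  have hlt := hE.norm_sharp_lt hz
  rw [eq_neg_of_add_eq_zero_right h, norm_neg] at hlt
  exact lt_irrefl _ hlt

/-- **Discharge of `Lagarias2006_thm1_if`** («`E_ξ` ∈ HB ⟹ RH», RH-FREE): if `E_ξ` is Hermite–Biehler
then `A = (E_ξ + E_ξ♯)/2 = ξ(½ − iz)` has no zeros in `ℂ₊` (`IsHermiteBiehler.add_sharp_ne_zero`),
none in `ℂ₋` by `A(z̄) = conj A(z)`, hence all zeros of `A` are real, which is RH
(`riemannHypothesis_iff_lagariasXiA_zeros_real`). The printed 5-line argument of [Su23b] p. 8 L1–4;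
no de Branges-space theory is used. [cite: Lagarias2006, Thm. 1 — secondary: Suzuki2023b, Prop. 3.1 (2)⇒(1), p. 7–8] -/
theorem Lagarias2006_thm1_if_holds : Lagarias2006_thm1_if := by
  intro hE
  rw [riemannHypothesis_iff_lagariasXiA_zeros_real]
  intro z hz
  by_contra him
  rcases lt_or_gt_of_ne him with hneg | hpos
  · have hc : 0 < (conj z).im := by rw [Complex.conj_im]; linarith
    refine hE.add_sharp_ne_zero hc ?_
    have h2 : lagariasXiA (conj z) = 0 := by rw [lagariasXiA_conj, hz, map_zero]
    unfold lagariasXiA at h2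
    simpa using h2
  · refine hE.add_sharp_ne_zero hpos ?_
    unfold lagariasXiA at hz
    simpa using hz

/-- **Discharge of `Lagarias2006_thm1_onlyif`** («RH ⟹ `E_ξ` ∈ HB», RH-CONSEQUENCE): with
`s = ½ − iz`, `Im z > 0 ⟺ Re s > ½`, and `‖E_ξ(z̄)‖ = ‖ξ(s) − ξ′(s)‖`, `‖E_ξ(z)‖ = ‖ξ(s) + ξ′(s)‖`
(`norm_lagariasE_conj`); the inequality `‖ξ − ξ′‖ < ‖ξ + ξ′‖` is `0 < Re(ξ′(s)·conj ξ(s))`, i.e.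
`ξ(s) ≠ 0 ∧ 0 < Re ξ′/ξ(s)`, which under RH is Lagarias 1999 (1.5)
(`Lagarias1999_riemannHypothesis_iff_holds`; Mathlib's `logDeriv` is `0` at a zero of `ξ`, so its
positivity also gives `ξ(s) ≠ 0`). Entire-ness: `differentiable_lagariasE`.
[cite: Lagarias2006, Thm. 1 — secondary: Suzuki2023b, Prop. 3.1 (1)⇒(2), p. 7; Suzuki2025WeilHilbertSpace, p. 2 L95] -/
theorem Lagarias2006_thm1_onlyif_holds : Lagarias2006_thm1_onlyif := by
  intro hRH
  refine ⟨differentiable_lagariasE, fun z hz ↦ ?_⟩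
  set s : ℂ := 1 / 2 - I * z with hs
  have hsre : 1 / 2 < s.re := by
    simp only [hs, sub_re, mul_re, I_re, I_im, zero_mul, one_mul, zero_sub]
    norm_num
    exact hz
  have hpos : 0 < (logDeriv riemannXi s).re := Lagarias1999_riemannHypothesis_iff_holds.mp hRH s hsre
  have hξ : riemannXi s ≠ 0 := by
    intro h0
    rw [logDeriv_apply, h0, div_zero, Complex.zero_re] at hpos
    exact lt_irrefl _ hpos
  -- `0 < Re (ξ′(s) · conj ξ(s)) = Re (ξ′/ξ)(s) · |ξ(s)|²`
  have hkey : 0 < (deriv riemannXi s * conj (riemannXi s)).re := by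
    have hrepr : deriv riemannXi s * conj (riemannXi s) =
        logDeriv riemannXi s * ((Complex.normSq (riemannXi s) : ℝ) : ℂ) := by
      rw [logDeriv_apply, Complex.normSq_eq_conj_mul_self]
      field_simp
    rw [hrepr, Complex.re_mul_ofReal]
    exact mul_pos hpos (Complex.normSq_pos.mpr hξ)
  have hE : lagariasE z = riemannXi s + deriv riemannXi s := rfl
  rw [norm_lagariasE_conj, hE, ← hs]
  -- compare squared norms
  have h1 : ‖riemannXi s - deriv riemannXi s‖ ^ 2 < ‖riemannXi s + deriv riemannXi s‖ ^ 2 := by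
    rw [Complex.sq_norm, Complex.sq_norm, Complex.normSq_sub, Complex.normSq_add]
    have hre : (riemannXi s * conj (deriv riemannXi s)).re =
        (deriv riemannXi s * conj (riemannXi s)).re := by
      rw [← Complex.conj_re (riemannXi s * conj (deriv riemannXi s)), map_mul, Complex.conj_conj,
        mul_comm]
    rw [hre]
    linarith
  exact lt_of_pow_lt_pow_left₀ 2 (norm_nonneg _) h1

/-- **Discharge of `Lagarias2006_thm1`** ([La06] Thm. 1: `E_ξ` ∈ HB ⟺ RH), from the two halves.
LABEL (l.1): RH-EQUIVALENT, PRINTED; a kernel-checked criterion, not progress toward RH.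
[cite: Lagarias2006, Thm. 1 — secondary: Suzuki2023b, Prop. 3.1 (1)⇔(2), p. 7] -/
theorem Lagarias2006_thm1_holds : Lagarias2006_thm1 :=
  ⟨Lagarias2006_thm1_onlyif_holds, Lagarias2006_thm1_if_holds⟩

end Literature.NumberTheory.LFunctions
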